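import Literature.MathematicalPhysics.QuantumLattice.TwoSpeciesCoordinates
import Literature.MathematicalPhysics.QuantumLattice.SpinTwistedHubbardTorus
import HarnessLib

/-!
# Route `LiebTwin`, crux `TwinOnsiteCondensation` (stmt-HubbardSuperconductivity-15258), line `majorant`:
# the spin-flip channel in Lieb coordinates (helper, `--supports`)

For the spin-flip family `O'_G = Σ_{x,y} G x y • c†_{x↑} c_{y↓}` and a vector `φ` of Lieb's `(n, n)` sector,
the two-species coefficient matrix of `O'_G φ` (which lives in the RECTANGULAR sector `(n+1, n-1)`) is

  `W(O'_G φ) = (-1)^n • Σ_{x,y} G x y • (C_x * liebW n φ * D_y)`,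

where `C_x = (creation x).submatrix id val` (the spinless `c†_x` with its column index restricted to
`n`-subsets) and `D_y = (creation y).submatrix val id = ((annihilation y)ᵀ restricted)` (the down-spin
`c_{y↓}` acts from the right by the transpose): `coeffMatrix_spinFlip_mulVec`. Consequently
`Re⟨φ, O'_Gᴴ O'_G φ⟩ = Σ_{γ,δ} ‖(Σ G x y • C_x W D_y)_{γδ}‖²` by unitarity of `ψ ↦ W(ψ)` on the whole Fock space
(`re_expect_spinFlip_eq_sum_norm_sq`). Ingredients: `TwoSpecies.coeffMatrix_creation_up_mulVec`
(`c†_{x↑}: W ↦ c†_x W`), `TwoSpecies.coeffMatrix_annihilation_down_mulVec` (`c_{y↓}: W ↦ P W c_yᵀ`, `P` the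
up-parity, constant `(-1)^n` on the sector) and the sector support of `W(φ)`.
Lieb, PRL **62** (1989) 1201, proof of Theorem 1; Tasaki (2020) §9.2.1. No definition and no named fact
is introduced.
-/

-- the mandated namespace `Summit.<Summit>.<Problem>.Theorems` repeats `HubbardSuperconductivity`
-- (single-problem summit, D-0017), which the `dupNamespace` linter flags on every declaration
set_option linter.dupNamespace false

noncomputable section

namespace Summit.HubbardSuperconductivity.HubbardSuperconductivity.Theorems.LiebTwinMajorant.SpinFlip

open Matrix Finset Literature.MathematicalPhysics.QuantumLattice
open scoped ComplexOrder

variable {Λ : Type*} [LinearOrder Λ] [Fintype Λ]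

/-- **One spin-flip term in Lieb coordinates.** For `φ` in the `(n, n)` sector,
`c†_x · (P · W(φ) · c_yᵀ) = (-1)^n • (C_x * liebW n φ * D_y)` with `C_x = (creation x).submatrix id val`,
`D_y = (creation y).submatrix val id`: the up-parity `P` is `(-1)^n` on the support of `W(φ)`, and the
products over all subsets restrict to `n`-subsets. Lieb, PRL 62 (1989) 1201, proof of Theorem 1.
[cite: LiebPRL1989, proof of Theorem 1] -/
theorem creation_mul_upParity_mul_coeffMatrix_mul {n : ℕ} {φ : Fock (Orb Λ)} (hφ : IsInSector n n φ)
    (x y : Λ) :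
    creation x * (TwoSpecies.upParity * TwoSpecies.coeffMatrix φ * (annihilation y)ᵀ) =
      ((-1 : ℂ) ^ n) • ((creation x).submatrix id (Subtype.val : Config Λ n → Finset Λ) * liebW n φ *
        (creation y).submatrix (Subtype.val : Config Λ n → Finset Λ) id) := by
  have hW := (TwoSpecies.isInSector_iff_coeffMatrix n n φ).1 hφ
  ext γ δ
  -- the common value of both entries: `(-1)^n Σ_{α,β : n-subsets} (c†_x)_{γα} W_{αβ} (c†_y)_{βδ}`
  set g : Finset Λ → Finset Λ → ℂ := fun t u =>
    creation x γ t * TwoSpecies.coeffMatrix φ t u * creation y u δ with hg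
  have hL : (creation x * (TwoSpecies.upParity * TwoSpecies.coeffMatrix φ * (annihilation y)ᵀ) :
      Matrix (Finset Λ) (Finset Λ) ℂ) γ δ =
      ∑ t : Finset Λ, ∑ u : Finset Λ, (-1 : ℂ) ^ n * g t u := by
    have hPW : TwoSpecies.upParity * TwoSpecies.coeffMatrix φ =
        Matrix.of fun t u => (-1 : ℂ) ^ t.card * TwoSpecies.coeffMatrix φ t u := by
      ext t u; rw [TwoSpecies.upParity, diagonal_mul, Matrix.of_apply]
    rw [annihilation_transpose, hPW]
    simp only [Matrix.mul_apply, Matrix.of_apply, Finset.mul_sum, hg]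
    refine Finset.sum_congr rfl fun t _ => Finset.sum_congr rfl fun u _ => ?_
    by_cases ht : t.card = n
    · rw [ht]; ring
    · rw [hW t u (fun h => ht h.1)]; ring
  have hR : ((creation x).submatrix id (Subtype.val : Config Λ n → Finset Λ) * liebW n φ *
        (creation y).submatrix (Subtype.val : Config Λ n → Finset Λ) id) γ δ =
      ∑ α : Config Λ n, ∑ β : Config Λ n, g α.1 β.1 := by
    simp only [Matrix.mul_apply, submatrix_apply, id_eq, Finset.sum_mul, hg]
    rw [Finset.sum_comm]
    rfl
  -- the sums over all subsets restrict to `n`-subsets (support of `W(φ)`)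
  have hS : ∑ t : Finset Λ, ∑ u : Finset Λ, g t u = ∑ α : Config Λ n, ∑ β : Config Λ n, g α.1 β.1 := by
    rw [← sum_config_eq_sum n (fun t => ∑ u : Finset Λ, g t u) (fun t ht =>
      Finset.sum_eq_zero fun u _ => by simp only [hg, hW t u (fun h => ht h.1), mul_zero, zero_mul])]
    refine Finset.sum_congr rfl fun α _ => ?_
    exact (sum_config_eq_sum n (fun u => g α.1 u) (fun u hu => by
      simp only [hg, hW α.1 u (fun h => hu h.2), mul_zero, zero_mul])).symm
  rw [Matrix.smul_apply, smul_eq_mul, hL, hR, ← hS]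
  simp only [Finset.mul_sum]

/-- **The spin-flip channel in Lieb coordinates.** For `φ` in the `(n, n)` sector and any kernel `G`,
`W(O'_G φ) = (-1)^n • Σ_{x,y} G x y • (C_x * liebW n φ * D_y)`, `O'_G = Σ G x y • c†_{x↑} c_{y↓}`.
Lieb, PRL 62 (1989) 1201, proof of Theorem 1; Tasaki (2020) §9.2.1. [cite: LiebPRL1989, proof of Theorem 1] -/
theorem coeffMatrix_spinFlip_mulVec {n : ℕ} {φ : Fock (Orb Λ)} (hφ : IsInSector n n φ) (G : Matrix Λ Λ ℂ) :
    TwoSpecies.coeffMatrix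
        ((∑ x : Λ, ∑ y : Λ, G x y • (creation (orb x 0) * annihilation (orb y 1))) *ᵥ φ) =
      ((-1 : ℂ) ^ n) • ∑ x : Λ, ∑ y : Λ, G x y •
        ((creation x).submatrix id (Subtype.val : Config Λ n → Finset Λ) * liebW n φ *
          (creation y).submatrix (Subtype.val : Config Λ n → Finset Λ) id) := by
  simp only [Matrix.sum_mulVec, Matrix.smul_mulVec, TwoSpecies.coeffMatrix_sum,
    TwoSpecies.coeffMatrix_smul, ← Matrix.mulVec_mulVec, TwoSpecies.coeffMatrix_creation_up_mulVec,
    TwoSpecies.coeffMatrix_annihilation_down_mulVec, creation_mul_upParity_mul_coeffMatrix_mul hφ,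
    Finset.smul_sum]
  exact Finset.sum_congr rfl fun x _ => Finset.sum_congr rfl fun y _ => smul_comm _ _ _

/-- `‖O'_G φ‖²` in Lieb coordinates: for `φ` in the `(n, n)` sector,
`Re⟨φ, O'_Gᴴ O'_G φ⟩ = Σ_{γ,δ} ‖(Σ_{x,y} G x y • (C_x * liebW n φ * D_y))_{γδ}‖²` (the transfer `ψ ↦ W(ψ)` is
unitary on the whole Fock space and the sign `(-1)^n` drops out). Lieb, PRL 62 (1989) 1201, proof of
Theorem 1 ("`⟨ψ|ψ⟩ = Σ |W_{αβ}|²`"). [cite: LiebPRL1989, proof of Theorem 1] -/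
theorem re_expect_spinFlip_eq_sum_norm_sq :
    ∀ {Λ : Type*} [LinearOrder Λ] [Fintype Λ] {n : ℕ} {φ : Fock (Orb Λ)}, IsInSector n n φ →
      ∀ G : Matrix Λ Λ ℂ,
        (expect ((∑ x : Λ, ∑ y : Λ, G x y • (creation (orb x 0) * annihilation (orb y 1)))ᴴ *
            (∑ x : Λ, ∑ y : Λ, G x y • (creation (orb x 0) * annihilation (orb y 1)))) φ).re =
          ∑ γ : Finset Λ, ∑ δ : Finset Λ, ‖(∑ x : Λ, ∑ y : Λ, G x y •
            ((creation x).submatrix id (Subtype.val : Config Λ n → Finset Λ) * liebW n φ *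
              (creation y).submatrix (Subtype.val : Config Λ n → Finset Λ) id)) γ δ‖ ^ 2 := by
  intro Λ _ _ n φ hφ G
  rw [Literature.MathematicalPhysics.QuantumLattice.expect, LiebThm1.star_dotProduct_conjTranspose_mul_mulVec,
    TwoSpecies.star_dotProduct_self_eq_sum_coeffMatrix, coeffMatrix_spinFlip_mulVec hφ, Complex.re_sum]
  refine Finset.sum_congr rfl fun γ _ => ?_
  rw [Complex.re_sum]
  refine Finset.sum_congr rfl fun δ _ => ?_
  rw [Complex.ofReal_re, Matrix.smul_apply, norm_smul, norm_pow, norm_neg, norm_one, one_pow, one_mul]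

end Summit.HubbardSuperconductivity.HubbardSuperconductivity.Theorems.LiebTwinMajorant.SpinFlip

end
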